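import Mathlib
import Literature.MathematicalPhysics.QuantumFieldTheory.Balaban1983to89.B5Block118

/-!
# B5 (1.16)–(1.18): the composition law of the block averages, `Q ∘ Q_{k−1} = Q_k` —
# kernel certificate of «It is easily seen that a composition of k transformations is given by …»

Source: T. Bałaban, *Propagators and renormalization transformations for lattice gauge
theories. I*, Commun. Math. Phys. **95** (1984) 17–40 (`Balaban1984PropagatorsI`, "B5"), render
`b2b-balaban-ref1/pages/1984-cmp95-propagators-rt-I/1984-cmp95-propagators-rt-I-p004-x2.png`
(PDF page 4 = journal page 20), read as an image by this seat (cell pub-balaban, SURGE NODE PROVER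
#13 gen 9, self-row `B5-COMP-116`).

## What the paper prints (verbatim, p. 20 [PDF 4], Sect. B «Compositions of Renormalization
## Transformations. Basic Sequence of Actions»)

«We can apply the renormalization transformation again to (1.14). A composition of two
transformations is easy to calculate:
((ST)²e^{−S})(C) = z^{(2)}∫dB δ(C − QB)δ_Ax(B)∫dA δ(B − QA)δ_Ax(A) exp(−S^{L^{−2}}(A))
 = z^{(2)}∫dA(∫dAδ(C − QB)δ(B − QA)δ_Ax(B))δ_Ax(A) exp(−S^{L^{−2}}(A))
 = z^{(2)}∫dA δ(C − Q₂A)δ_Ax(QA)δ_Ax(A)exp(−S^{L^{−2}}(A)), (1.16)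
where z^{(2)} is a numerical factor coming from scaling transformations and Q₂ is defined as Q only
with the number L replaced by L² in all definitions. It is easily seen that a composition of k
transformations is given by
((ST)^k e^{−S})(B) = z^{(k)}∫dAδ(B − Q_kA)δ_Ax(Q_{k−1}A)·…·δ_Ax(A)e^{−S^η(A)}, (1.17)
where
(Q_kA)_b = Σ_{x∈B^k(b₋)} η^{d+1}A([x, x(b)]), b ⊂ T₁^{(k)} = ℤ^d ∩ T_η, η = L^{−k}, (1.18)
and x(b) is a point in B^k(b₊) obtained from x by translation by b. If b = ⟨y, y + e_μ⟩, then
x(b) = x + e_μ.»;  further down the page: «or denoting (Q′_kλ)(y) = Σ_{x∈B^k(y)} η^dλ(x), we have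
Q_kA^λ = Q_kA − ∂Q′_kλ.» ((1.20)).

The step that is «easy to calculate» / «easily seen» and not displayed is the operator identity
behind the last member of (1.16) and behind (1.17): integrating `δ(C − QB)δ(B − QA)` over `B`
leaves `δ(C − Q(QA))`, and the `L`-block average of the `L`-block averages (re-read after the
rescaling `S`) IS the `L²`-block average, `Q(QA) = Q₂A`; inductively `Q(Q_{k−1}A) = Q_kA` with
`Q_k` of (1.18).  The cell's census certifies this only by re-derivation and numerics (GAPS C-B5-7:
«(1.16) Q(Q_jA) = Q_(j+1)A ✓ (composition of the averaging contours; second engine: exact on the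
torus to 10⁻¹⁵, d = 2, 3, 4, kit j038533 test E9)»).  THIS FILE is its kernel certificate over the
tree's own typed averages `B5Block118.QvOp` («Q_k», (1.18)) and `B5Block118.QsOp` («Q′_k»,
(1.20)), in the scale-free torus typing of `B5Block118` (all lengths in `η`-units, the rescalings
`S` absorbed in the weights `η^{d+1}` / `η^d`), as the TWO-FACTOR SEMIGROUP LAW
`Q_m ∘ Q_n = Q_{mn}`: with `m = L`, `n = L^{k−1}` it is `Q ∘ Q_{k−1} = Q_k` ((1.16) for `k = 2`,
(1.17) by induction on `k`).

## What is typed here (dictionary)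

Three nested tori (all of `B5Prop11Plancherel`): the unit lattice `Tor M` (`T₁^{(k)}`), the
intermediate lattice `Tor (fine m M)` (spacing `m⁻¹`; in print the unit lattice of the previous
step, `m = L`), and the fine lattice `T_η`, which the tree knows under TWO names:
`Tor (fine n (fine m M))` (moduli `n·(m·M_ν)`, the domain of the inner average `QvOp n (fine m M)`)
and `Tor (fine (m * n) M)` (moduli `(m·n)·M_ν`, the domain of the total average `QvOp (m * n) M`).
The two index types are equal only propositionally, so the identification of sites is the
canonical reindexing `recast : Tor N ≃ Tor N'` along `N ν = N' ν` (componentwise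
`ZMod.ringEquivCongr`; it maps lattice vectors `t e_μ` to `t e_μ` and integer-coordinate points to
themselves, §1), specialised to `sites : Tor (fine (m * n) M) ≃ Tor (fine n (fine m M))`.  With it:

* §2 `bpt_bpt` — THE BLOCKS NEST: the point `j₁ ∈ {0,…,n−1}^d` of the `n`-block at the point
  `j₂ ∈ {0,…,m−1}^d` of the `m`-block at `y` is the point `J = j₁ + n·j₂` (componentwise;
  `finProdFinEquiv`) of the `mn`-block at `y` — «B^k(y)» of (1.18) for `mn` versus `m` and `n`;
  `bpt_bpt_tstep` — the same with the contour offsets of «[x, x(b)]»: `t₂` intermediate steps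
  followed by `t₁` fine steps are `t₁ + n·t₂` fine steps; `sum_J`, `sum_T` — the corresponding
  reindexings of the block and contour sums (bijections `{0..m−1}^d × {0..n−1}^d ≃ {0..mn−1}^d`,
  `{0..m−1} × {0..n−1} ≃ {0..mn−1}`).
* §3 `QsOp_comp_mulVec` / `QsOp_comp` — the scalar law for «Q′_k» of (1.20):
  `QsOp m M * (QsOp n (fine m M)).submatrix id sites = QsOp (m * n) M`
  (weights `m^{−d}·n^{−d} = (mn)^{−d}`).
* §4 `lineSum_lineSum` — the straight contour `[x, x + e_μ]` of `mn` fine bonds is the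
  concatenation of the `m` contours of `n` fine bonds starting at `x + t₂·(n fine steps)`, `t₂ < m`;
  `QvOp_comp_mulVec` / `QvOp_comp` — THE COMPOSITION LAW for «Q_k» of (1.18):
  `QvOp m M * (QvOp n (fine m M)).submatrix id (sites × id) = QvOp (m * n) M`
  (weights `m^{−(d+1)}·n^{−(d+1)} = (mn)^{−(d+1)}`).

No analytic content: finite sums and two reindexing bijections.  Consumers: the inductive structure
of (1.17) wherever the tree composes averaging steps (e.g. the multi-step toy records of the T4
rung `t4/T4-RUNG-O3Ei-gamma2a.md`, identity (E6) `S_k(L) = S₁(L^k)`, ingredient (a)).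

Tags: `[cite: Balaban1984PropagatorsI, (1.16)–(1.18) p.20]` on the two composition laws, the
contour concatenation and the block-nesting identities they rest on; `[folklore]` on the
reindexing tools.
-/

noncomputable section

open scoped BigOperators Matrix
open Finset

namespace Literature.MathematicalPhysics.QuantumFieldTheory.Balaban1983to89.B5Composition116

open Literature.MathematicalPhysics.QuantumFieldTheory.Balaban1983to89.B5Prop11Plancherel
open Literature.MathematicalPhysics.QuantumFieldTheory.Balaban1983to89.B5Block118

/-! ## §1. Reindexing sites along equal moduli -/

section Recast

variable {d : ℕ} {N N' : Fin d → ℕ}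

/-- the canonical identification of the tori `Π_ν ℤ/N_ν` and `Π_ν ℤ/N'_ν` when `N_ν = N'_ν`
(componentwise `ZMod.ringEquivCongr`). [folklore] -/
def recast (h : ∀ ν, N ν = N' ν) : Tor N ≃ Tor N' where
  toFun x ν := ZMod.ringEquivCongr (h ν) (x ν)
  invFun x ν := (ZMod.ringEquivCongr (h ν)).symm (x ν)
  left_inv x := funext fun ν => by simp
  right_inv x := funext fun ν => by simp

/-- `recast` acts componentwise. [folklore] -/
theorem recast_apply (h : ∀ ν, N ν = N' ν) (x : Tor N) (ν : Fin d) :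
    recast h x ν = ZMod.ringEquivCongr (h ν) (x ν) := rfl

/-- `recast` is additive. [folklore] -/
theorem recast_add (h : ∀ ν, N ν = N' ν) (x y : Tor N) :
    recast h (x + y) = recast h x + recast h y := by
  funext ν
  simp [recast_apply]

/-- `recast` fixes integer-coordinate vectors. [folklore] -/
theorem recast_natCast (h : ∀ ν, N ν = N' ν) (c : Fin d → ℕ) :
    recast h (fun ν => ((c ν : ℕ) : ZMod (N ν))) = fun ν => ((c ν : ℕ) : ZMod (N' ν)) := by
  funext ν
  simp [recast_apply]

/-- `recast (t e_μ) = t e_μ`. [folklore] -/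
theorem recast_tstep (h : ∀ ν, N ν = N' ν) (μ : Fin d) (t : ℕ) :
    recast h (tstep N μ t) = tstep N' μ t := by
  funext ν
  by_cases hν : ν = μ
  · subst hν
    simp [recast_apply, tstep]
  · simp [recast_apply, tstep, hν]

/-- `(a + b) e_μ = a e_μ + b e_μ`. [folklore] -/
theorem tstep_add (μ : Fin d) (a b : ℕ) : tstep N μ (a + b) = tstep N μ a + tstep N μ b := by
  funext ν
  by_cases hν : ν = μ
  · subst hν
    simp [tstep]
  · simp [tstep, hν]

end Recast

/-! ## §2. Nested blocks: `B^{j+1}(y) = ⋃_{x ∈ B(y)} B^j(x)` pointwise -/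

section Offsets

variable {d : ℕ} (m n : ℕ) (M : Fin d → ℕ)

/-- the two names of the fine torus have equal moduli: `(m·n)·M_ν = n·(m·M_ν)`. [folklore] -/
theorem fine_fine (ν : Fin d) : fine (m * n) M ν = fine n (fine m M) ν := by
  show m * n * M ν = n * (m * M ν)
  ring

/-- the site identification `T_{(mn)⁻¹}` (moduli `(mn)M_ν`) `≃` (moduli `n(mM_ν)`). [folklore] -/
def sites : Tor (fine (m * n) M) ≃ Tor (fine n (fine m M)) := recast (fine_fine m n M)

/-- `up` on integer coordinates: `up (c) = n·c`. [folklore] -/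
theorem up_natCast (c : Fin d → ℕ) :
    up n M (fun ν => ((c ν : ℕ) : ZMod (M ν))) = fun ν => ((n * c ν : ℕ) : ZMod (fine n M ν)) := by
  funext ν
  have h := upHom_intCast n M ν (c ν : ℤ)
  simp only [up]
  push_cast at h ⊢
  exact h

/-- `up (t e_μ) = (n t) e_μ`: `t` steps of the coarse lattice are `n t` fine steps. [folklore] -/
theorem up_tstep (μ : Fin d) (t : ℕ) : up n M (tstep M μ t) = tstep (fine n M) μ (n * t) := by
  funext ν
  by_cases hν : ν = μ
  · subst hν
    have h := upHom_intCast n M ν (t : ℤ)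
    simp only [up, tstep]
    push_cast at h ⊢
    exact h
  · simp [up, tstep, hν]

/-- `up_n (ι_m j₂) = n·j₂`. [folklore] -/
theorem up_iota (j₂ : Fin d → Fin m) :
    up n (fine m M) (iota m M j₂) = fun ν => ((n * (j₂ ν : ℕ) : ℕ) : ZMod (fine n (fine m M) ν)) :=
  up_natCast n (fine m M) fun ν => (j₂ ν : ℕ)

/-- the combined block offset `J_ν = j₁,ν + n·j₂,ν ∈ {0,…,mn−1}` of the outer offset `j₂ ∈ {0,…,m−1}^d`
and the inner offset `j₁ ∈ {0,…,n−1}^d`. [cite: Balaban1984PropagatorsI, (1.16)–(1.18) p.20] -/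
def J (j₂ : Fin d → Fin m) (j₁ : Fin d → Fin n) : Fin d → Fin (m * n) :=
  fun ν => finProdFinEquiv (j₂ ν, j₁ ν)

/-- `J_ν = j₁,ν + n·j₂,ν`. [folklore] -/
theorem J_val (j₂ : Fin d → Fin m) (j₁ : Fin d → Fin n) (ν : Fin d) :
    ((J m n j₂ j₁ ν : ℕ)) = (j₁ ν : ℕ) + n * (j₂ ν : ℕ) := by
  simp [J]

/-- `(j₂, j₁) ↦ J` is a bijection `{0..m−1}^d × {0..n−1}^d ≃ {0..mn−1}^d`. [folklore] -/
def JEquiv : (Fin d → Fin m) × (Fin d → Fin n) ≃ (Fin d → Fin (m * n)) :=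
  (Equiv.arrowProdEquivProdArrow (Fin d) (fun _ => Fin m) (fun _ => Fin n)).symm.trans
    (Equiv.piCongrRight fun _ => finProdFinEquiv)

/-- `JEquiv` is `J`. [folklore] -/
theorem JEquiv_apply (p : (Fin d → Fin m) × (Fin d → Fin n)) : JEquiv m n p = J m n p.1 p.2 := rfl

/-- double block sums are single block sums: `Σ_{j₂} Σ_{j₁} g(J(j₂,j₁)) = Σ_J g(J)`. [folklore] -/
theorem sum_J {β : Type*} [AddCommMonoid β] (g : (Fin d → Fin (m * n)) → β) :
    ∑ j₂ : Fin d → Fin m, ∑ j₁ : Fin d → Fin n, g (J m n j₂ j₁) = ∑ Jx : Fin d → Fin (m * n), g Jx := by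
  rw [← Fintype.sum_prod_type', ← Equiv.sum_comp (JEquiv m n) g]
  rfl

/-- double contour sums are single contour sums: `Σ_{t₂<m} Σ_{t₁<n} h(t₁ + n t₂) = Σ_{T<mn} h(T)`.
[folklore] -/
theorem sum_T {β : Type*} [AddCommMonoid β] (h : ℕ → β) :
    ∑ t₂ : Fin m, ∑ t₁ : Fin n, h ((t₁ : ℕ) + n * (t₂ : ℕ)) = ∑ T : Fin (m * n), h (T : ℕ) := by
  rw [← Fintype.sum_prod_type', ← Equiv.sum_comp finProdFinEquiv (fun T : Fin (m * n) => h (T : ℕ))]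
  simp

end Offsets

section Nesting

variable {d : ℕ} (m n : ℕ) (M : Fin d → ℕ) [hM : ∀ μ, NeZero (M μ)]

/-- `up_n (up_m y) = up_{mn} y` (read through `sites`). [folklore] -/
theorem up_up (y : Tor M) :
    up n (fine m M) (up m M y) = sites m n M (up (m * n) M y) := by
  have hy : y = fun ν => (((y ν).val : ℕ) : ZMod (M ν)) := funext fun ν => (ZMod.natCast_zmod_val _).symm
  rw [hy, up_natCast, up_natCast, up_natCast, sites, recast_natCast]
  funext ν
  congr 1
  ring

/-- THE BLOCKS NEST: the point `j₁` of the `n`-block at the point `j₂` of the `m`-block at `y` is the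
point `J = j₁ + n j₂` of the `mn`-block at `y` («B^k(y)», (1.18), for `k = j+1` versus `j` and `1`).
[cite: Balaban1984PropagatorsI, (1.16)–(1.18) p.20] -/
theorem bpt_bpt (y : Tor M) (j₂ : Fin d → Fin m) (j₁ : Fin d → Fin n) :
    bpt n (fine m M) (bpt m M y j₂) j₁ = sites m n M (bpt (m * n) M y (J m n j₂ j₁)) := by
  simp only [bpt, up_add, up_up, up_iota, sites, recast_add]
  rw [show iota (m * n) M (J m n j₂ j₁) = fun ν => (((J m n j₂ j₁ ν : ℕ)) : ZMod (fine (m * n) M ν))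
      from rfl, recast_natCast]
  rw [add_assoc]
  congr 1
  funext ν
  simp only [iota, Pi.add_apply, J_val]
  push_cast
  ring

/-- … and with the contour offsets: `t₂` intermediate steps then `t₁` fine steps are `t₁ + n t₂` fine
steps («x(b) = x + e_μ» walked bond by bond). [cite: Balaban1984PropagatorsI, (1.16)–(1.18) p.20] -/
theorem bpt_bpt_tstep (y : Tor M) (j₂ : Fin d → Fin m) (j₁ : Fin d → Fin n) (μ : Fin d) (t₂ t₁ : ℕ) :
    bpt n (fine m M) (bpt m M y j₂ + tstep (fine m M) μ t₂) j₁ + tstep (fine n (fine m M)) μ t₁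
      = sites m n M (bpt (m * n) M y (J m n j₂ j₁) + tstep (fine (m * n) M) μ (t₁ + n * t₂)) := by
  have e1 : bpt n (fine m M) (bpt m M y j₂ + tstep (fine m M) μ t₂) j₁
      = bpt n (fine m M) (bpt m M y j₂) j₁ + tstep (fine n (fine m M)) μ (n * t₂) := by
    simp only [bpt, up_add, up_tstep]
    abel
  rw [e1, bpt_bpt, sites, recast_add, recast_tstep, tstep_add, add_assoc]
  congr 1
  exact add_comm _ _

end Nesting

/-! ## §3. The scalar law `Q′_m ∘ Q′_n = Q′_{mn}` for the block means «(Q′_kλ)(y) = Σ_{x∈B^k(y)} η^dλ(x)» -/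

section Scalar

variable {d : ℕ} (m n : ℕ) [NeZero m] [NeZero n] (M : Fin d → ℕ) [hM : ∀ μ, NeZero (M μ)]

/-- `Q′_m(Q′_n λ) = Q′_{mn} λ` pointwise: averaging the `n`-fold block means of `λ` over the `m`-blocks
gives the `mn`-fold block average (the field on the fine torus read through `sites`).
[cite: Balaban1984PropagatorsI, (1.16)–(1.18) p.20] -/
theorem QsOp_comp_mulVec (f : Tor (fine (m * n) M) → ℂ) (y : Tor M) :
    (QsOp m M *ᵥ (QsOp n (fine m M) *ᵥ (f ∘ (sites m n M).symm))) y = (QsOp (m * n) M *ᵥ f) y := by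
  rw [QsOp_mulVec, QsOp_mulVec]
  simp_rw [QsOp_mulVec, Function.comp_apply, bpt_bpt, Equiv.symm_apply_apply]
  rw [← Finset.mul_sum, sum_J m n (fun Jx => f (bpt (m * n) M y Jx)), ← mul_assoc]
  congr 1
  have hm : (m : ℂ) ≠ 0 := by exact_mod_cast NeZero.ne m
  have hn : (n : ℂ) ≠ 0 := by exact_mod_cast NeZero.ne n
  push_cast
  rw [mul_pow]
  field_simp

/-- THE SCALAR COMPOSITION LAW as an identity of matrices `T₁^{(k)} ← T_{(mn)⁻¹}`:
`Q′_m ∘ Q′_n = Q′_{mn}`. [cite: Balaban1984PropagatorsI, (1.16)–(1.18) p.20] -/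
theorem QsOp_comp :
    QsOp m M * (QsOp n (fine m M)).submatrix id (sites m n M) = QsOp (m * n) M := by
  rw [Matrix.ext_iff_mulVec]
  intro f
  funext y
  rw [← Matrix.mulVec_mulVec, Matrix.submatrix_mulVec_equiv, Function.comp_id, QsOp_comp_mulVec]

end Scalar

/-! ## §4. (1.16)/(1.17): `Q ∘ Q_{k−1} = Q_k` for the averages «(Q_kA)_b = Σ_{x∈B^k(b₋)} η^{d+1}A([x, x(b)])» (1.18) -/

section VectorSites

variable {d : ℕ} (m n : ℕ) (M : Fin d → ℕ)

/-- the site identification on (site, direction) pairs. [folklore] -/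
def sitesV : Tor (fine (m * n) M) × Fin d ≃ Tor (fine n (fine m M)) × Fin d :=
  (sites m n M).prodCongr (Equiv.refl (Fin d))

/-- `sitesV` acts on the site only. [folklore] -/
theorem sitesV_symm_apply (x : Tor (fine n (fine m M))) (μ : Fin d) :
    (sitesV m n M).symm (x, μ) = ((sites m n M).symm x, μ) := rfl

end VectorSites

section Vector

variable {d : ℕ} (m n : ℕ) (M : Fin d → ℕ) [hM : ∀ μ, NeZero (M μ)]

/-- the contour `[x, x + e_μ]` of `mn` fine bonds is the concatenation of `m` contours of `n` fine
bonds: `Σ_{t₂<m} A([x + t₂·(n bonds), …]) = A([x, x + e_μ])`.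
[cite: Balaban1984PropagatorsI, (1.16)–(1.18) p.20] -/
theorem lineSum_lineSum (A : Tor (fine (m * n) M) × Fin d → ℂ) (y : Tor M) (j₂ : Fin d → Fin m)
    (j₁ : Fin d → Fin n) (μ : Fin d) :
    ∑ t₂ : Fin m, lineSum n (fine m M) (A ∘ (sitesV m n M).symm)
        (bpt n (fine m M) (bpt m M y j₂ + tstep (fine m M) μ t₂) j₁) μ
      = lineSum (m * n) M A (bpt (m * n) M y (J m n j₂ j₁)) μ := by
  simp only [lineSum, Function.comp_apply, sitesV_symm_apply, bpt_bpt_tstep, Equiv.symm_apply_apply]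
  exact sum_T m n (fun T => A (bpt (m * n) M y (J m n j₂ j₁) + tstep (fine (m * n) M) μ T, μ))

variable [NeZero m] [NeZero n]

/-- `Q_m(Q_n A) = Q_{mn} A` pointwise on bonds `b = ⟨y, y + e_μ⟩` of the unit lattice: the
`m`-fold average (1.18) of the `n`-fold average (1.18) of `A` is the `mn`-fold average (1.18) of `A`
(read through `sites`). [cite: Balaban1984PropagatorsI, (1.16)–(1.18) p.20] -/
theorem QvOp_comp_mulVec (A : Tor (fine (m * n) M) × Fin d → ℂ) (y : Tor M) (μ : Fin d) :
    (QvOp m M *ᵥ (QvOp n (fine m M) *ᵥ (A ∘ (sitesV m n M).symm))) (y, μ)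
      = (QvOp (m * n) M *ᵥ A) (y, μ) := by
  rw [QvOp_mulVec, QvOp_mulVec]
  simp only [lineSum.eq_def m M, QvOp_mulVec]
  simp_rw [← Finset.mul_sum]
  rw [← mul_assoc]
  have hsum : ∑ j₂ : Fin d → Fin m, ∑ t₂ : Fin m, ∑ j₁ : Fin d → Fin n,
      lineSum n (fine m M) (A ∘ (sitesV m n M).symm)
        (bpt n (fine m M) (bpt m M y j₂ + tstep (fine m M) μ t₂) j₁) μ
      = ∑ Jx : Fin d → Fin (m * n), lineSum (m * n) M A (bpt (m * n) M y Jx) μ := by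
    rw [← sum_J m n (fun Jx => lineSum (m * n) M A (bpt (m * n) M y Jx) μ)]
    refine Finset.sum_congr rfl fun j₂ _ => ?_
    rw [Finset.sum_comm]
    refine Finset.sum_congr rfl fun j₁ _ => ?_
    exact lineSum_lineSum m n M A y j₂ j₁ μ
  rw [hsum]
  congr 1
  have hm : (m : ℂ) ≠ 0 := by exact_mod_cast NeZero.ne m
  have hn : (n : ℂ) ≠ 0 := by exact_mod_cast NeZero.ne n
  push_cast
  rw [mul_pow]
  field_simp

/-- THE COMPOSITION LAW of the averages (1.18) as an identity of matrices
`(T₁^{(k)} × {1..d}) ← (T_{(mn)⁻¹} × {1..d})`: `Q_m ∘ Q_n = Q_{mn}`.  With `m = n = L` this is the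
identity `Q(QA) = Q₂A` behind the last member of (1.16) («Q₂ is defined as Q only with the number
L replaced by L² in all definitions»); with `m = L`, `n = L^{k−1}` it is the inductive step
`Q(Q_{k−1}A) = Q_kA` of (1.17), «η = L^{−k}». [cite: Balaban1984PropagatorsI, (1.16)–(1.18) p.20] -/
theorem QvOp_comp :
    QvOp m M * (QvOp n (fine m M)).submatrix id (sitesV m n M) = QvOp (m * n) M := by
  rw [Matrix.ext_iff_mulVec]
  intro A
  funext b
  obtain ⟨y, μ⟩ := b
  rw [← Matrix.mulVec_mulVec, Matrix.submatrix_mulVec_equiv, Function.comp_id, QvOp_comp_mulVec]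

end Vector

end Literature.MathematicalPhysics.QuantumFieldTheory.Balaban1983to89.B5Composition116
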